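import Literature.NumberTheory.Transcendental.KaehlerHodgeSmoothProofs
import Literature.NumberTheory.Transcendental.DolbeaultIntegrabilityProofs
import HarnessLib

/-!
# `∂*` of a smooth complex form is smooth: corrected statement of the named fact

Companion of `Literature/NumberTheory/Transcendental/KaehlerHodge.lean` (C12), §*Generic smoothness
statements*, written for the named fact
`Literature.NumberTheory.Transcendental.isSmoothForm_dolbeaultAdjoint` ("`∂*` of a smooth form is
smooth (holomorphic atlas, smooth metric)"; Huybrechts (2005), Def. 3.1.3:
`∂* := -∗ ∘ ∂̄ ∘ ∗ : 𝒜^{p,q}(X) → 𝒜^{p-1,q}(X)` on an hermitian manifold `(X, g)`). The analytic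
content is G21's `Literature.Geometry.Kaehler.IsSmoothForm.hodgeStar` through
`Literature.Geometry.Kaehler.IsSmoothForm.cHodgeStar` of `KaehlerHodgeSmoothProofs.lean` (which
also carries the analogous correction of `isSmoothForm_cHodgeStar`); the public dot-notation form
`Literature.Geometry.Kaehler.IsSmoothForm.dolbeaultAdjoint` lives in
`KaehlerHodgeLaplacianDProofs.lean` (not imported here, to keep this record light; the four-line
argument is repeated in a private helper). This file records the status of the named fact itself.

## Main statements (all proved)

* `isSmoothForm_dolbeaultAdjoint_of_isContMDiffRiemannianBundle` (named fact, the **corrected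
  statement** of `isSmoothForm_dolbeaultAdjoint`) and its discharge
  `isSmoothForm_dolbeaultAdjoint_of_isContMDiffRiemannianBundle_holds`.
* `isSmoothForm_dolbeaultAdjoint_of_contMDiffMetric`: bridge to the named fact *as declared*, in
  the presence of the intended instances (feed it to any hypothesis
  `(h : isSmoothForm_dolbeaultAdjoint o)`).

## Correction of `isSmoothForm_dolbeaultAdjoint`

The named fact `isSmoothForm_dolbeaultAdjoint` of `KaehlerHodge.lean` (like its siblings
`isSmoothForm_cHodgeStar`, `isSmoothForm_dolbeaultBarAdjoint`) is declared in `section Smooth`,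
whose instance variables `[IsManifold 𝓘(ℂ, E) ω M] [IsManifold 𝓘(ℝ, E) ∞ M]
[IsContinuousRiemannianBundle E (TangentSpace 𝓘(ℝ, E))]
[IsContMDiffRiemannianBundle 𝓘(ℝ, E) ∞ E (TangentSpace 𝓘(ℝ, E))]` are *not used in its body* and
hence (a `def` abstracts only the section variables it mentions) are **not** hypotheses of the
fact: `#check @isSmoothForm_dolbeaultAdjoint` lists `[RiemannianBundle (TangentSpace 𝓘(ℝ, E))]` —
Mathlib's fibrewise family of inner products of *no regularity in the base point* — as the only
assumption on the metric, and no assumption at all on the atlas of the charted space `M`. As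
declared, the fact therefore asserts smoothness of `∂*α` for *rough* metrics too, which is false.
Counterexample: `M = E = ℂ` (`n = 2`), the metric `g = λ dx² + λ⁻¹ dy²` with `λ = 2` on the closed
upper half plane and `λ = 1` on the open lower one (`det g = 1`, so the volume form of the
standard orientation is the constant `dx ∧ dy` and the hypothesis `ho` holds), degrees
`k + 1 = 2`, `m = 0`, and the smooth `2`-form `α = \bar z · dx ∧ dy`: then `⋆α = \bar z`,
`∂̄ ⋆α = (d\bar z)^{0,1} = d\bar z` and `∂*α = -⋆ d\bar z = -(⋆dx - i ⋆dy) = -(λ⁻¹ dy + i λ dx)`,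
which is not continuous at any point of the real axis. This is the same defect as for G21's
`Literature.Geometry.Kaehler.isSmoothForm_hodgeStar`, settled in
`Literature/Geometry/Kaehler/RiemannianHodgeSmoothProofs.lean` (corrected fact
`isSmoothForm_hodgeStar_of_isContMDiffRiemannianBundle`) and refuted as declared in
`Literature/Geometry/Kaehler/RiemannianHodgeRoughMetric.lean` (`not_forall_isSmoothForm_hodgeStar`),
and as for `isSmoothForm_cHodgeStar` (`KaehlerHodgeSmoothProofs.lean`). Following those precedents,
the corrected fact below binds the intended hypotheses
`[IsManifold 𝓘(ℂ, E) ω M] [IsManifold 𝓘(ℝ, E) ∞ M] [IsContMDiffRiemannianBundle 𝓘(ℝ, E) ∞ E _]`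
*inside* a closed statement (`IsContinuousRiemannianBundle` is not needed); the original def is
left untouched (D-0014: never edit a fact's meaning in place) and has no consumers.

In Huybrechts (2005) the standing hypotheses are exactly these: `X` is a complex manifold
(holomorphic atlas, Def. 2.1.1) and an hermitian structure `g` is a Riemannian metric — smooth by
definition — compatible with the complex structure (Def. 3.1.1); compatibility is not needed for
smoothness and is not assumed here.

## Proof

`∂* = -⋆∂̄⋆` is a composite of the `ℂ`-linear star (`⋆(a + ib) = ⋆a + i⋆b`, smooth by Warner
(1983), 4.10 (6) for the smooth metric: `IsSmoothForm.cHodgeStar`, from G21's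
`IsSmoothForm.hodgeStar`), of `∂̄ = ∑ Π^{p,q+1} ∘ d ∘ Π^{p,q}` (smooth since `d` preserves
smoothness, Warner (1983), Thm. 2.20, and the type projections do on a complex manifold,
Voisin (2002), §2.3.1: C10's `isSmoothForm_dolbeaultBar` fed the discharged
`isSmoothForm_typeComponent_holds` and `IsSmoothForm.mextDeriv`), and of the sign `-1` — the
interim proof preserved under the fact in `KaehlerHodge.lean`, with its ingredients now theorems
(private helper `dolbeaultAdjoint_isSmoothForm_aux`; public form
`Literature.Geometry.Kaehler.IsSmoothForm.dolbeaultAdjoint` in `KaehlerHodgeLaplacianDProofs.lean`).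

## References

* D. Huybrechts, *Complex Geometry. An Introduction*, Universitext, Springer (2005), §3.1,
  Def. 3.1.3 (`∂*`, `∂̄*` on an hermitian manifold), Def. 3.1.1; §3.2, Lemma 3.2.3.
* C. Voisin, *Hodge Theory and Complex Algebraic Geometry I* (2002), §2.3.1, §5.1.1.
* F. W. Warner, *Foundations of Differentiable Manifolds and Lie Groups*, GTM 94 (1983), 4.10 (6),
  p. 150; 6.1, p. 220.
-/

noncomputable section

open scoped Manifold ContDiff Topology
open Bundle Module Set

namespace Literature.NumberTheory.Transcendental

/-! ### The named fact as declared, under the intended instances -/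

section Adjoint

variable {E : Type*} [NormedAddCommGroup E] [NormedSpace ℂ E]
  {M : Type*} [TopologicalSpace M] [ChartedSpace E M] {k m : ℕ}
  [FiniteDimensional ℂ E] {n : ℕ} [Fact (finrank ℝ E = n)]
  [RiemannianBundle (fun x : M ↦ TangentSpace 𝓘(ℝ, E) x)]
  (o : (x : M) → Orientation ℝ (TangentSpace 𝓘(ℝ, E) x) (Fin n))
  [IsManifold 𝓘(ℂ, E) ω M] [IsManifold 𝓘(ℝ, E) ∞ M]
  [IsContMDiffRiemannianBundle 𝓘(ℝ, E) ∞ E (fun x : M ↦ TangentSpace 𝓘(ℝ, E) x)]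

/-- `∂*α = -⋆∂̄⋆α` is smooth for smooth `α` (holomorphic atlas, smooth metric, orientation family
with smooth volume form): `⋆` (`IsSmoothForm.cHodgeStar`), then `∂̄` (C10's
`isSmoothForm_dolbeaultBar` fed `isSmoothForm_typeComponent_holds` and `IsSmoothForm.mextDeriv`),
then `⋆` and the sign. Private copy of `Literature.Geometry.Kaehler.IsSmoothForm.dolbeaultAdjoint`
(`KaehlerHodgeLaplacianDProofs.lean`), kept local so that this file does not import the Laplacian
development. Huybrechts (2005), Def. 3.1.3. [cite: HuybrechtsCG2005, Def. 3.1.3] -/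
private theorem dolbeaultAdjoint_isSmoothForm_aux
    (ho : Literature.Geometry.Kaehler.IsSmoothForm (Literature.Geometry.Kaehler.riemannianVolumeForm o))
    (h : (k + 1) + m = n) {α : Literature.Geometry.Kaehler.MForm 𝓘(ℝ, E) M ℂ (k + 1)}
    (hα : Literature.Geometry.Kaehler.IsSmoothForm α) :
    Literature.Geometry.Kaehler.IsSmoothForm (dolbeaultAdjoint o h α) := by
  unfold Literature.NumberTheory.Transcendental.dolbeaultAdjoint
  rw [← neg_one_smul ℂ]
  exact (Literature.Geometry.Kaehler.IsSmoothForm.cHodgeStar o ho _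
    (isSmoothForm_dolbeaultBar isSmoothForm_typeComponent_holds (fun hβ ↦ hβ.mextDeriv)
      (Literature.Geometry.Kaehler.IsSmoothForm.cHodgeStar o ho h hα))).smul_complex (-1)

/-- **Bridge to the named fact as declared.** In the presence of the intended instances
(holomorphic atlas `IsManifold 𝓘(ℂ, E) ω M`, `IsManifold 𝓘(ℝ, E) ∞ M`, smooth metric
`IsContMDiffRiemannianBundle 𝓘(ℝ, E) ∞`), the over-general named fact
`isSmoothForm_dolbeaultAdjoint o` of `KaehlerHodge.lean` holds (in all degrees).
Huybrechts (2005), Def. 3.1.3. [cite: HuybrechtsCG2005, Def. 3.1.3] -/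
theorem isSmoothForm_dolbeaultAdjoint_of_contMDiffMetric :
    isSmoothForm_dolbeaultAdjoint (k := k) (m := m) o :=
  fun ho h _ hα ↦ dolbeaultAdjoint_isSmoothForm_aux o ho h hα

end Adjoint

/-! ### The corrected named fact -/

section CorrectedFact

/-- **Corrected statement of the named fact
`Literature.NumberTheory.Transcendental.isSmoothForm_dolbeaultAdjoint`** (`KaehlerHodge.lean`):
on a complex manifold (holomorphic atlas) with a *smooth* Riemannian metric on the real tangent
bundle and an orientation family `o` with smooth volume form, `∂*α = -⋆∂̄⋆α` is smooth for every
smooth complex `(k+1)`-form `α` (Huybrechts (2005), Def. 3.1.3: on an hermitian manifold `(X, g)`,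
`∂* := -∗ ∘ ∂̄ ∘ ∗` is an operator `𝒜^{p,q}(X) → 𝒜^{p-1,q}(X)` between spaces of smooth forms;
there `X` is a complex manifold, Def. 2.1.1, and `g` is a Riemannian — smooth — metric,
Def. 3.1.1; its compatibility with the complex structure plays no role for smoothness and is not
assumed).

Discrepancy with the original: the `def isSmoothForm_dolbeaultAdjoint` of `KaehlerHodge.lean` is
declared in a section whose instance variables `[IsManifold 𝓘(ℂ, E) ω M]`,
`[IsManifold 𝓘(ℝ, E) ∞ M]`, `[IsContinuousRiemannianBundle E (TangentSpace 𝓘(ℝ, E))]`,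
`[IsContMDiffRiemannianBundle 𝓘(ℝ, E) ∞ E (TangentSpace 𝓘(ℝ, E))]` are *not used in its body*,
hence are not part of the definition (a `def` abstracts only the section variables it mentions):
as declared, it asserts smoothness of `∂*α` for *every* fibrewise family of inner products
(`Bundle.RiemannianBundle` carries no regularity in the base point) on *every* charted space,
which is false — on `ℂ` take `g = λ dx² + λ⁻¹ dy²` with `λ = 2` on the closed upper and `λ = 1` on
the open lower half plane and `α = \bar z dx ∧ dy` (`k + 1 = 2`, `m = 0`): the volume form
`dx ∧ dy` and `α` are smooth, `⋆α = \bar z`, `∂̄⋆α = d\bar z`, but `∂*α = -(λ⁻¹ dy + iλ dx)` is not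
even continuous (cf. `Literature.Geometry.Kaehler.RiemannianHodgeRoughMetric.not_forall_isSmoothForm_hodgeStar`
for the same phenomenon with G21's `isSmoothForm_hodgeStar`, and
`isSmoothForm_cHodgeStar_of_isContMDiffRiemannianBundle` of `KaehlerHodgeSmoothProofs.lean`).
Here the intended hypotheses are bound *inside* a closed statement
(`IsContinuousRiemannianBundle` is not needed); it is discharged by
`isSmoothForm_dolbeaultAdjoint_of_isContMDiffRiemannianBundle_holds`, the usable form is
`Literature.Geometry.Kaehler.IsSmoothForm.dolbeaultAdjoint`, and the original fact holds as
declared whenever the instances are present (`isSmoothForm_dolbeaultAdjoint_of_contMDiffMetric`).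
[cite: HuybrechtsCG2005, Def. 3.1.3] -/
def isSmoothForm_dolbeaultAdjoint_of_isContMDiffRiemannianBundle : Prop :=
  ∀ {E : Type*} [NormedAddCommGroup E] [NormedSpace ℂ E]
    {M : Type*} [TopologicalSpace M] [ChartedSpace E M]
    [IsManifold 𝓘(ℂ, E) ω M] [IsManifold 𝓘(ℝ, E) ∞ M] {k m : ℕ}
    [FiniteDimensional ℂ E] {n : ℕ} [Fact (finrank ℝ E = n)]
    [RiemannianBundle (fun x : M ↦ TangentSpace 𝓘(ℝ, E) x)]
    [IsContMDiffRiemannianBundle 𝓘(ℝ, E) ∞ E (fun x : M ↦ TangentSpace 𝓘(ℝ, E) x)]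
    (o : (x : M) → Orientation ℝ (TangentSpace 𝓘(ℝ, E) x) (Fin n)),
    Literature.Geometry.Kaehler.IsSmoothForm (Literature.Geometry.Kaehler.riemannianVolumeForm o) →
      ∀ (h : (k + 1) + m = n) {α : Literature.Geometry.Kaehler.MForm 𝓘(ℝ, E) M ℂ (k + 1)},
        Literature.Geometry.Kaehler.IsSmoothForm α →
          Literature.Geometry.Kaehler.IsSmoothForm (dolbeaultAdjoint o h α)

/-- **Discharge** of `isSmoothForm_dolbeaultAdjoint_of_isContMDiffRiemannianBundle` (the corrected
form of the named fact `isSmoothForm_dolbeaultAdjoint`): the bridge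
`isSmoothForm_dolbeaultAdjoint_of_contMDiffMetric` at the instances bound by the statement.
Huybrechts (2005), Def. 3.1.3. [cite: HuybrechtsCG2005, Def. 3.1.3] -/
theorem isSmoothForm_dolbeaultAdjoint_of_isContMDiffRiemannianBundle_holds :
    isSmoothForm_dolbeaultAdjoint_of_isContMDiffRiemannianBundle :=
  fun o ho h _ hα ↦ isSmoothForm_dolbeaultAdjoint_of_contMDiffMetric o ho h hα

end CorrectedFact

end Literature.NumberTheory.Transcendental
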